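import Mathlib
import Summits.ResolutionOfSingularities.ResolutionOfSingularities.Theorems.WildQuotientsWildQuotientResolutionJordanThreeK3Charts

/-!
# Programme V4U, smooth chart: the augmentation ideal on `D₊(x_c⁶ t)` of `Bl_{I₆}` is `(x_c)` — ANY characteristic

(crux stmt-ResolutionOfSingularities-15640 `WildQuotients.WildQuotientResolution`, line `Sketch`,
sector `|G| = p`; programme V4U of `L/w45c/CHAIN.md` v5 §NEXT (res-L1-w45c-stub-4 FINDING V4U-Q-W3/5
02:15:15Z (1): «smooth chart … aug = (e) principal: TERMINAL (any p)»); [OURS · L1 W4.5c] — NOT a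
statement of any manuscript.)

On the smooth vertex chart `D₊(x_c⁶ t) = Spec k[v, u, x_c, …]` of `Bl_{I₆} 𝔸ⁿ` (`x_a = v x_c³`,
`x_b = u x_c²`; `JordanFour.isRegularRing_chartRing_I6_c`, p489593) a `J₄`-type ring endomorphism `a`
(`a x_a = x_a`, `a x_b = x_b + m x_a`, `a x_c = x_c + m x_b + m' x_a`; every `g ∈ ⟨σ⟩` has this
shape) satisfies `a x_c = x_c·w` with `w ≡ 1 (mod x_c)`, `w³·a(v) = v`, `w²·a(u) = u + m x_c v`, so
every move lies in `(x_c)` and the ideal `(x_a, x_b, x_c) + (a e_l − e_l)_l` — the augmentation ideal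
read through the chart package — is the principal ideal `(x_c)` (`chartC_span_eq`, the `I₆` analogue
of `ToricExit.chartB_span_eq` / `JordanThree.k3_chart4_span_eq`). VECTOR OF RECORD:
`![x_a², x_a x_b², x_a x_b x_c, x_a x_c³, x_b³, x_b²x_c², x_b x_c⁴, x_c⁶]`, chart index `7`.
-/

-- single-problem summit: the doubled namespace component `ResolutionOfSingularities` is forced
set_option linter.dupNamespace false

noncomputable section

namespace Summit.ResolutionOfSingularities.ResolutionOfSingularities.Theorems.WildQuotientResolution.JordanFour

open JordanThree in
/-- **Chart `D₊(x_c⁶ t)` of `Bl_{I₆}`, augmentation ideal `(x_c)`** (any characteristic, any `m, m'`):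
in a domain with `x_c⁶ · e_l = (I₆-generator)_l`, `a x_a = x_a`, `a x_b = x_b + m x_a`,
`a x_c = x_c + m x_b + m' x_a`, one has `(x_a, x_b, x_c) + (a e_l − e_l)_l = (x_c)`.
[OURS · L1 W4.5c] [folklore] -/
theorem chartC_span_eq {S : Type} [CommRing S] [IsDomain S] (xa xb xc m m' : S) (hxc : xc ≠ 0)
    (a : S →+* S) (ha : a xa = xa) (hb : a xb = xb + m * xa) (hc : a xc = xc + m * xb + m' * xa)
    (e : {l : Fin 8 // l ≠ (7 : Fin 8)} → S)
    (he : ∀ l, xc ^ 6 * e l = (![xa ^ 2, xa * xb ^ 2, xa * xb * xc, xa * xc ^ 3, xb ^ 3,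
      xb ^ 2 * xc ^ 2, xb * xc ^ 4, xc ^ 6] : Fin 8 → S) l.1) :
    Ideal.span ({xa, xb, xc} : Set S) ⊔ Ideal.span (Set.range fun l => a (e l) - e l) =
      Ideal.span ({xc} : Set S) := by
  set e0 : S := e ⟨0, by decide⟩ with he0
  set e1 : S := e ⟨1, by decide⟩ with he1
  set e2 : S := e ⟨2, by decide⟩ with he2
  set v : S := e ⟨3, by decide⟩ with hv
  set e4 : S := e ⟨4, by decide⟩ with he4
  set e5 : S := e ⟨5, by decide⟩ with he5
  set u : S := e ⟨6, by decide⟩ with hu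
  have h0 : xc ^ 6 * e0 = xa ^ 2 := he ⟨0, by decide⟩
  have h1 : xc ^ 6 * e1 = xa * xb ^ 2 := he ⟨1, by decide⟩
  have h2 : xc ^ 6 * e2 = xa * xb * xc := he ⟨2, by decide⟩
  have h3 : xc ^ 6 * v = xa * xc ^ 3 := he ⟨3, by decide⟩
  have h4 : xc ^ 6 * e4 = xb ^ 3 := he ⟨4, by decide⟩
  have h5 : xc ^ 6 * e5 = xb ^ 2 * xc ^ 2 := he ⟨5, by decide⟩
  have h6 : xc ^ 6 * u = xb * xc ^ 4 := he ⟨6, by decide⟩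
  -- the monomial parametrisation `x_a = x_c³ v`, `x_b = x_c² u`
  have hxa : xc ^ 3 * v = xa := by
    have h : xc ^ 3 * (xc ^ 3 * v) = xc ^ 3 * xa := by linear_combination h3
    exact mul_left_cancel₀ (pow_ne_zero 3 hxc) h
  have hxb : xc ^ 2 * u = xb := by
    have h : xc ^ 4 * (xc ^ 2 * u) = xc ^ 4 * xb := by linear_combination h6
    exact mul_left_cancel₀ (pow_ne_zero 4 hxc) h
  have he0' : e0 = v ^ 2 := by
    have h : xc ^ 6 * e0 = xc ^ 6 * v ^ 2 := by rw [h0, ← hxa]; ring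
    exact mul_left_cancel₀ (pow_ne_zero 6 hxc) h
  have he1' : e1 = xc * v * u ^ 2 := by
    have h : xc ^ 6 * e1 = xc ^ 6 * (xc * v * u ^ 2) := by rw [h1, ← hxa, ← hxb]; ring
    exact mul_left_cancel₀ (pow_ne_zero 6 hxc) h
  have he2' : e2 = v * u := by
    have h : xc ^ 6 * e2 = xc ^ 6 * (v * u) := by rw [h2, ← hxa, ← hxb]; ring
    exact mul_left_cancel₀ (pow_ne_zero 6 hxc) h
  have he4' : e4 = u ^ 3 := by
    have h : xc ^ 6 * e4 = xc ^ 6 * u ^ 3 := by rw [h4, ← hxb]; ring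
    exact mul_left_cancel₀ (pow_ne_zero 6 hxc) h
  have he5' : e5 = u ^ 2 := by
    have h : xc ^ 6 * e5 = xc ^ 6 * u ^ 2 := by rw [h5, ← hxb]; ring
    exact mul_left_cancel₀ (pow_ne_zero 6 hxc) h
  -- the action: `a x_c = x_c · w`, `w = 1 + m x_c u + m' x_c² v`
  set w : S := 1 + m * (xc * u) + m' * (xc ^ 2 * v) with hw
  have hc' : a xc = xc * w := by rw [hc, ← hxa, ← hxb, hw]; ring
  have hav : a v * w ^ 3 = v := by
    have h := congrArg a hxa
    rw [map_mul, map_pow, ha, hc', ← hxa] at h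
    have h' : xc ^ 3 * (a v * w ^ 3) = xc ^ 3 * v := by linear_combination h
    exact mul_left_cancel₀ (pow_ne_zero 3 hxc) h'
  have hau : a u * w ^ 2 = u + m * (xc * v) := by
    have h := congrArg a hxb
    rw [map_mul, map_pow, hb, hc', ← hxa, ← hxb] at h
    have h' : xc ^ 2 * (a u * w ^ 2) = xc ^ 2 * (u + m * (xc * v)) := by linear_combination h
    exact mul_left_cancel₀ (pow_ne_zero 2 hxc) h'
  -- the moves land in `(x_c)`
  set I : Ideal S := Ideal.span ({xc} : Set S) with hI
  have hxcI : xc ∈ I := Ideal.subset_span (Set.mem_singleton _)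
  have hmxc : a xc - xc ∈ I := by
    refine Ideal.mem_span_singleton'.mpr ⟨m * (xc * u) + m' * (xc ^ 2 * v), ?_⟩
    rw [hc', hw]; ring
  have hmv : a v - v ∈ I := by
    refine Ideal.mem_span_singleton'.mpr
      ⟨-(a v * ((m * u + m' * (xc * v)) * (w ^ 2 + w + 1))), ?_⟩
    have hw1 : w - 1 = xc * (m * u + m' * (xc * v)) := by rw [hw]; ring
    linear_combination (-1 : S) * hav + a v * (w ^ 2 + w + 1) * hw1
  have hmu : a u - u ∈ I := by
    refine Ideal.mem_span_singleton'.mpr ⟨m * v - a u * ((m * u + m' * (xc * v)) * (w + 1)), ?_⟩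
    have hw1 : w - 1 = xc * (m * u + m' * (xc * v)) := by rw [hw]; ring
    linear_combination (-1 : S) * hau + a u * (w + 1) * hw1
  apply le_antisymm
  · refine sup_le ?_ ?_
    · refine Ideal.span_le.mpr ?_
      intro x hx
      simp only [Set.mem_insert_iff, Set.mem_singleton_iff] at hx
      rcases hx with rfl | rfl | rfl
      · rw [← hxa]
        exact Ideal.mem_span_singleton'.mpr ⟨xc ^ 2 * v, by ring⟩
      · rw [← hxb]
        exact Ideal.mem_span_singleton'.mpr ⟨xc * u, by ring⟩
      · exact hxcI
    · refine Ideal.span_le.mpr ?_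
      rintro _ ⟨⟨l, hl⟩, rfl⟩
      fin_cases l
      · change a e0 - e0 ∈ I
        rw [he0']
        exact map_pow_sub_pow_mem a I hmv 2
      · change a e1 - e1 ∈ I
        rw [he1']
        exact map_mul_sub_mul_mem a I (map_mul_sub_mul_mem a I hmxc hmv)
          (map_pow_sub_pow_mem a I hmu 2)
      · change a e2 - e2 ∈ I
        rw [he2']
        exact map_mul_sub_mul_mem a I hmv hmu
      · exact hmv
      · change a e4 - e4 ∈ I
        rw [he4']
        exact map_pow_sub_pow_mem a I hmu 3
      · change a e5 - e5 ∈ I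
        rw [he5']
        exact map_pow_sub_pow_mem a I hmu 2
      · exact hmu
      · exact absurd rfl hl
  · rw [hI, Ideal.span_singleton_le_iff_mem]
    exact Ideal.mem_sup_left (Ideal.subset_span
      (Set.mem_insert_of_mem _ (Set.mem_insert_of_mem _ (Set.mem_singleton _))))

end Summit.ResolutionOfSingularities.ResolutionOfSingularities.Theorems.WildQuotientResolution.JordanFour

end
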